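import Summits.ResolutionOfSingularities.ResolutionOfSingularities.Theorems.HilbertSamuelEliminationSigmaMaxModificationsCorridor3WLadderSegmentsTowerEnds
import Summits.ResolutionOfSingularities.ResolutionOfSingularities.Theorems.HilbertSamuelEliminationSigmaMaxModificationsCorridor3WLadderSegmentsIso
import Summits.ResolutionOfSingularities.ResolutionOfSingularities.Theorems.HilbertSamuelEliminationSigmaMaxModificationsCorridor3WLadderSegmentsDefs
import Summits.ResolutionOfSingularities.ResolutionOfSingularities.Theorems.HilbertSamuelEliminationSigmaMaxModificationsCorridor3WLadderCharHypothesis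
import Summits.ResolutionOfSingularities.ResolutionOfSingularities.Theorems.HilbertSamuelEliminationSigmaMaxModificationsCorridor3RegularValue
import HarnessLib

/-!
# [OURS · L1 W4.2] THE UNITS-HALF EXTRACTION: a moving chain, cut at its blown-up isolated stages, IS a unit-wise localised chain of
# fundamental units — modulo the CENTRE DISCIPLINE of CJS Def. 6.38 (ii)′–(v) (the recognition half)
# (crux `SigmaMaxModifications` stmt-ResolutionOfSingularities-18506; conjunct `SigmaMaxModificationsCorridor3` stmt-…-19249; line `w_ladder` v6;
# plan-1 RULINGS v3.10-1 (A) «U-seg = segment extraction»; closes `Moving.UnitTowerExtractionLocQM p` modulo `Seg.UnitRecognitionAtQM`)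

Stub worker res-L1-w42-stub-1 (gen 3). Helper file `--supports stmt-ResolutionOfSingularities-19249 --as helper`; kernel only, no named fact.

* `Seg.UnitCentreDiscipline T N m x` — the four clauses of `IsFundamentalUnit` that concern the LATER centres (CJS Def. 6.38 (ii)′ `C_1 = ℙ(Dir_x)`,
  (iii) `C_q = φ_q⁻¹(x) ∩ X_q(ν)`, (iv) `C_q ⥲ C_{q−1}`, (v) `π_m : C_m → C_{m−1}` not surjective), verbatim.
* `Seg.isFundamentalUnit_unitTower` — **the unit tower based at a blown-up isolated stage `b` IS a fundamental unit** from `𝔪_{x_b}` to the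
  point over `x_{b'}`, GIVEN the centre discipline: the other eleven clauses of Def. 6.38 are discharged (`…SegmentsTower`, `…SegmentsTowerEnds`,
  `…UnitStart`; `(e, ē) = (2, 2)` at isolated stages).
* `Seg.exists_localizedChain` — **THE EXTRACTION**: along a chain from a maximal origin (functional admissible oracle, `ν ≠ Φ^{(N)}`) blown up
  and isolated infinitely often with `(2, 2)` at isolated stages, given (H-emp) and the centre discipline at every blown-up isolated stage and
  (F1) along the chain: towers `T i = unitTower (segBase i)`, lengths, initial and terminal points forming an
  `IsLocalizedChainOfFundamentalUnits` with `KeySetting`, `CharHypothesis` and isolation at every initial point.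
* `Seg.UnitRecognitionAtQM p Q` — the recognition half as ONE origin-predicate statement (binder list of `UnitTowerExtractionLocAtQM`, then:
  at every blown-up isolated stage, (H-emp) and the centre discipline of its unit tower), and
  **`Moving.unitTowerExtractionLocQM_of_recognition : UnitRecognitionAtQM p (QCharRegime p) → UnitTowerExtractionLocQM p`**
  (`ν = Φ^{(3)}` is vacuous by `…RegularValue`: no genuine step; (F1) by `…WLadderCharHypothesis`).

OURS bookkeeping; NOT a statement of the manuscript [Hironaka2017] nor of [CossartJannsenSaito2020]. AI-written; AI review is weaker than
expert review.

References: V. Cossart, U. Jannsen, S. Saito, LNM 2270 (2020), Def. 6.38, Def. 6.39, Thm. 6.40, p. 107 [CossartJannsenSaito2020].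
-/

noncomputable section

set_option linter.dupNamespace false -- namespace `…Corridor3.Moving` re-enters `…Corridor3` (module convention of the Moving files)

open CategoryTheory AlgebraicGeometry TopologicalSpace Topology IsLocalRing
open Literature.AlgebraicGeometry.Resolution Literature.RingTheory.HilbertSamuel
open Literature.AlgebraicGeometry.CossartJannsenSaito2020
open Summit.ResolutionOfSingularities.ResolutionOfSingularities.Theorems.CampaignW42
open Summit.ResolutionOfSingularities.ResolutionOfSingularities.Theorems.SigmaMaxModificationsCorridor3.Helpers

namespace Summit.ResolutionOfSingularities.ResolutionOfSingularities.Theorems.SigmaMaxModificationsCorridor3.Moving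

namespace Seg

universe u

/-! ## §1. The centre discipline and the fundamental unit -/

/-- [OURS] **THE CENTRE DISCIPLINE of CJS Def. 6.38 (ii)′ (iii) (iv) (v)** for a tower `T` read as a unit of length `m` from `x ∈ X_0` at
level `N` — exactly the clauses `centre_one`, `centre_near`, `iso`, `not_surjective` of `IsFundamentalUnit`, i.e. what the units-half
extraction does NOT discharge (the recognition half). [cite: CossartJannsenSaito2020, Def. 6.38] -/
def UnitCentreDiscipline (T : BlowupTower.{u}) (N m : ℕ) (x : T.X 0) : Prop :=
  (2 ≤ m → T.C 1 = T.projDir x) ∧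
    (∀ q : ℕ, 2 ≤ q → q + 1 ≤ m → T.C q = T.nearLocus N x q) ∧
    (∀ j : ℕ, 1 ≤ j → j + 1 < m →
      InducesIsoOn (T.π j) (T.C (j + 1)) (T.isClosed_C (j + 1)) (T.C j) (T.isClosed_C j)) ∧
    (∀ j : ℕ, 1 ≤ j → m = j + 1 → ¬ (T.C j ⊆ (T.π j).base '' T.nearLocus N x (j + 1)))

section Extraction

variable {R : ∀ S : Scheme.{0}, CentreSeq S → Prop} {N : ℕ} {ν : ℕ → ℕ} {k : Type} [Field k]
  {c : ℕ → MarkedStage.{0}} (hc : ∀ n, CanonicalNearStep R N ν (c n) (c (n + 1))) (hRf : OracleFunctional R) (hRa : OracleAdmissible R)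
  (hν : ν ≠ iterPSum N Phi) (h0 : Helpers.CycleInv k N ν (c 0)) (hgen : ∀ n, ∃ m, n ≤ m ∧ (c m).IsBlownUp R N ν)
  (hBG : ∀ n, ∃ m, n ≤ m ∧ (c m).IsBlownUp R N ν ∧ Iso N (c m))
  {p : ℕ} {X : Scheme.{0}} [IsLocallyNoetherian X] {x : X} (hX : IsMaximalOrigin p N ν X x)
  (hreach : Reaches R N ν (MarkedStage.init X x) (c 0)) (h22 : ∀ n, Iso N (c n) → dirDim (c n) = 2 ∧ (c n).geomDirDim = 2)

include hc hRa hν hX hreach in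
/-- At an isolated stage of the chain, the marked point is isolated in its `ν`-stratum (good state). [cite: CossartJannsenSaito2020, Def. 13.3] -/
theorem stratumIsolated_at (b : ℕ) (hiso : Iso N (c b)) :
    ∃ U : Set (c b).W, IsOpen U ∧ (c b).pt ∈ U ∧ U ∩ Scheme.hsStratum (c b).W N ν ⊆ {(c b).pt} := by
  obtain ⟨k', _, _, hg⟩ := hX.exists_stateGood_of_reaches hRa hν (reaches_chain hreach hc b)
  exact stratumIsolated_of_iso hg hiso

include hc hX hreach in
/-- `H^N(x_n) = ν` along the chain. [folklore] -/
theorem hsFun_pt (n : ℕ) : Scheme.hsFun (c n).W N (c n).pt = ν :=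
  Scheme.mem_hsStratum_iff.mp (pt_mem_hsStratum_of_reaches hX.mem_stratum (reaches_chain hreach hc n))

include hRf hX hreach h22 in
/-- **THE UNIT TOWER AT A BLOWN-UP ISOLATED STAGE IS A FUNDAMENTAL UNIT, given the centre discipline** (CJS Def. 6.38): all other clauses are
discharged. [cite: CossartJannsenSaito2020, Def. 6.38, p. 107] -/
theorem isFundamentalUnit_unitTower (b : ℕ) (hb : (c b).IsBlownUp R N ν) (hiso : Iso N (c b)) (hemp : HEmp hc hRa hν h0 b)
    (hdisc : UnitCentreDiscipline (unitTower hc hRa hν h0 hgen b hemp) N (unitLen hgen hBG b) (basePt hc hRa hν h0 b)) :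
    IsFundamentalUnit (unitTower hc hRa hν h0 hgen b hemp) N (unitLen hgen hBG b) (basePt hc hRa hν h0 b)
      (termPt hc hRa hν h0 hgen hBG b hemp) where
  one_le_length := one_le_unitLen hgen hBG b
  isClosed_point := isClosed_basePt hc hRa hν h0 hgen b hemp
  dirDim_eq := (dirDimAt_unitTower_zero hc hRa hν h0 hgen b hemp).trans (h22 b hiso).1
  geomDirDim_eq := (geomDirDimAt_unitTower_zero hc hRa hν h0 hgen b hemp).trans (h22 b hiso).2
  centre_zero := unitTower_C_zero hc hRa hν h0 hgen hRf hX b hemp (reaches_chain hreach hc b) hb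
    (stratumIsolated_at hc hRa hν hX hreach b hiso)
  centre_one := hdisc.1
  centre_near := hdisc.2.1
  permissible q _ := isPermissible_centreIdeal_unitTower hc hRa hν h0 hgen b hemp q
  iso := hdisc.2.2.1
  not_surjective := hdisc.2.2.2
  isClosed_terminal := isClosed_termPt hc hRa hν h0 hgen hBG hX.isClosed b hemp (reaches_chain hreach hc _)
  terminal_over := phi_termPt hc hRa hν h0 hgen hBG b hemp
  terminal_near := by
    rw [hsFun_unitTower_terminal, hsFun_unitTower_zero, hsFun_pt hc hX hreach, hsFun_pt hc hX hreach]
  terminal_dirDim := (dirDimAt_unitTower_terminal hc hRa hν h0 hgen hBG b hemp).trans (h22 _ (Seg.G_nextBase hgen hBG b)).1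
  terminal_geomDirDim :=
    (geomDirDimAt_unitTower_terminal hc hRa hν h0 hgen hBG b hemp).trans (h22 _ (Seg.G_nextBase hgen hBG b)).2

/-! ## §2. The extraction -/

include hRf hX hreach h22 in
/-- **THE UNITS-HALF EXTRACTION.** Given (H-emp) and the centre discipline at every blown-up isolated stage, and (F1) along the chain, the unit
towers at the bases `segBase 0 < segBase 1 < ⋯` form a unit-wise localised chain of fundamental units with the setting, (F1) and isolation
at every initial point. [cite: CossartJannsenSaito2020, Def. 6.38, Def. 6.39, Thm. 6.40, p. 107] -/
theorem exists_localizedChain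
    (hemp : ∀ b, (c b).IsBlownUp R N ν → Iso N (c b) → HEmp hc hRa hν h0 b)
    (hdisc : ∀ b (hb : (c b).IsBlownUp R N ν) (hiso : Iso N (c b)),
      UnitCentreDiscipline (unitTower hc hRa hν h0 hgen b (hemp b hb hiso)) N (unitLen hgen hBG b) (basePt hc hRa hν h0 b))
    (hchar : ∀ n, CharHypothesis (c n).W (c n).pt) :
    ∃ (T : ℕ → BlowupTower.{0}) (len : ℕ → ℕ) (pt : ∀ i, (T i).X 0) (tpt : ∀ i, (T i).X (len i)),
      IsLocalizedChainOfFundamentalUnits T N len pt tpt ∧ KeySetting (T 0) N ∧ CharHypothesis ((T 0).X 0) (pt 0) ∧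
      ∀ i, @IsIsolatedInHSMaxLocus ((T i).X 0) ((T i).ln 0) N (pt i) := by
  have hB : ∀ i, (c (segBase hgen hBG i)).IsBlownUp R N ν := Seg.B_segBase hgen hBG
  have hG : ∀ i, Iso N (c (segBase hgen hBG i)) := Seg.G_segBase hgen hBG
  refine ⟨fun i => unitTower hc hRa hν h0 hgen (segBase hgen hBG i) (hemp _ (hB i) (hG i)), fun i => unitLen hgen hBG (segBase hgen hBG i),
    fun i => basePt hc hRa hν h0 (segBase hgen hBG i), fun i => termPt hc hRa hν h0 hgen hBG (segBase hgen hBG i) (hemp _ (hB i) (hG i)),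
    ⟨?_, ?_, ?_⟩, ?_, ?_, ?_⟩
  · exact isLocalAt_unitTower hc hRa hν h0 hgen (segBase hgen hBG 0) _
  · exact fun i => isFundamentalUnit_unitTower hc hRf hRa hν h0 hgen hBG hX hreach h22 (segBase hgen hBG i) (hB i) (hG i) _ (hdisc _ (hB i) (hG i))
  · exact fun i => isLocalSchemeAt_unitTower_terminal hc hRa hν h0 hgen hBG (segBase hgen hBG i) _
  · exact keySetting_unitTower hc hRa hν h0 hgen (segBase hgen hBG 0) _
  · exact charHypothesis_unitTower hc hRa hν h0 hgen (segBase hgen hBG 0) _ (hchar _)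
  · intro i
    have hcyc : Helpers.CycleInv k N ν (c (segBase hgen hBG i)) := cycleInv_at hc hRa hν h0 _
    refine isIsolatedInHSMaxLocus_unitTower hc hRa hν h0 hgen (segBase hgen hBG i) _
      (fun y hy => hsFun_le_of_specializes_of_cycleInv hcyc hy) ?_
    rw [hsFun_pt hc hX hreach]
    exact stratumIsolated_at hc hRa hν hX hreach _ (hG i)

end Extraction

/-! ## §3. The recognition half as one statement, and the extraction for `UnitTowerExtractionLocQM p` -/

/-- [OURS · L1 W4.2] **THE RECOGNITION HALF over an origin predicate `Q`** (stub-2's object): after the binder list of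
`UnitTowerExtractionLocAtQM p Q` and the auxiliary data of the extraction (ground field and cycle invariant at `c 0`, `ν ≠ Φ^{(3)}`, the
blown-up isolated stages), AT EVERY BLOWN-UP ISOLATED STAGE `b`: (H-emp) `Seg.HEmp … b` (waiting steps have empty localised centres) and the
CENTRE DISCIPLINE `Seg.UnitCentreDiscipline` of the unit tower `Seg.unitTower … b` (CJS Def. 6.38 (ii)′ `C_1 = ℙ(Dir)`, (iii) `C_q` = near
locus, (iv) `C_q ⥲ C_{q−1}`, (v) non-surjectivity — Thm. 3.14 / Lemma 6.33 territory). All proof arguments are irrelevant (any choice will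
do). [cite: CossartJannsenSaito2020, Def. 6.38, Thm. 3.14] -/
def UnitRecognitionAtQM (p : ℕ) (Q : ℕ → (ℕ → ℕ) → ∀ X : Scheme.{0}, X → Prop) : Prop :=
  ∀ (R : ∀ S : Scheme.{0}, CentreSeq S → Prop) (_ : OracleFunctional R) (hRa : OracleAdmissible R)
    (ν : ℕ → ℕ) (X : Scheme.{0}) [IsLocallyNoetherian X] (x : X), IsMaximalOrigin p 3 ν X x → Q 3 ν X x →
  ∀ (c : ℕ → MarkedStage.{0}), Reaches R 3 ν (MarkedStage.init X x) (c 0) →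
    ∀ (hc : ∀ n, CanonicalNearStep R 3 ν (c n) (c (n + 1))), (∀ n, (c n).geomDirDim ≤ 2) →
    ∀ (hgen : ∀ n, ∃ m, n ≤ m ∧ (c m).IsBlownUp R 3 ν), (∀ n, ∃ m, n ≤ m ∧ Iso 3 (c m)) →
    (∀ n, Iso 3 (c n) → dirDim (c n) = 2 ∧ (c n).geomDirDim = 2) →
    ∀ (k : Type) (_ : Field k) (h0 : Helpers.CycleInv k 3 ν (c 0)) (hν : ν ≠ iterPSum 3 Phi)
      (hBG : ∀ n, ∃ m, n ≤ m ∧ (c m).IsBlownUp R 3 ν ∧ Iso 3 (c m)) (b : ℕ),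
      (c b).IsBlownUp R 3 ν → Iso 3 (c b) →
        ∃ he : Seg.HEmp hc hRa hν h0 b,
          Seg.UnitCentreDiscipline (Seg.unitTower hc hRa hν h0 hgen b he) 3 (Seg.unitLen hgen hBG b) (Seg.basePt hc hRa hν h0 b)

end Seg

/-- **THE UNITS-HALF EXTRACTION IN THE (F1) REGIME, MODULO RECOGNITION**: `Seg.UnitRecognitionAtQM p (QCharRegime p) → UnitTowerExtractionLocQM p`
— the case `ν = Φ^{(3)}` is vacuous (no genuine step from a maximal origin of the regular value, `…RegularValue`), the cut stages exist
(`…SegmentsIso`), (F1) holds along the chain (`…WLadderCharHypothesis`), and `Seg.exists_localizedChain` assembles the rest.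
[cite: CossartJannsenSaito2020, Def. 6.38, Def. 6.39, Thm. 6.40, p. 107] -/
theorem unitTowerExtractionLocQM_of_recognition (p : ℕ) (hrec : Seg.UnitRecognitionAtQM p (QCharRegime p)) :
    UnitTowerExtractionLocQM p := by
  intro R hRf hRa ν X _ x hX hq c hreach hc hē hgen hIso h22
  -- `ν ≠ Φ^{(3)}`: otherwise no stage reached from the origin is blown up
  have hν : ν ≠ iterPSum 3 Phi := by
    intro hν
    obtain ⟨m, -, hm⟩ := hgen 0
    exact hX.not_isBlownUp_of_eq_iterPSum hRf hRa hν (reaches_chain hreach hc m) (hc m) hm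
  obtain ⟨k, _, hcyc⟩ := Helpers.CycleInv.init (N := 3) (ν := ν) hX
  have h0 : Helpers.CycleInv k 3 ν (c 0) := hcyc.of_reaches hRa hν hreach
  have hBG := Seg.exists_isBlownUp_and_iso hRa hν hX hreach hc hgen hIso
  have hrec' := hrec R hRf hRa ν X x hX hq c hreach hc hē hgen hIso h22 k inferInstance h0 hν hBG
  exact Seg.exists_localizedChain hc hRf hRa hν h0 hgen hBG hX hreach h22 (fun b hb hiso => (hrec' b hb hiso).choose)
    (fun b hb hiso => (hrec' b hb hiso).choose_spec) (fun n => charHypothesis_of_chain hX hq hreach hc n (c n).pt)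

end Summit.ResolutionOfSingularities.ResolutionOfSingularities.Theorems.SigmaMaxModificationsCorridor3.Moving

end
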